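import Literature.NumberTheory.LFunctions.DegreeOnePrimesPNT
import Literature.NumberTheory.Sieve.BatemanHornProofs
import Mathlib.NumberTheory.LegendreSymbol.Basic
import Mathlib.Algebra.Polynomial.SpecificDegree
import HarnessLib

/-!
# Primes for which `D` is a quadratic (non-)residue: Chebyshev and Mertens estimates with rate

For a non-square integer `D` let `ω_D(p) = #{n mod p : n² ≡ D (mod p)}` be the number of square
roots of `D` modulo the prime `p` (the tree's `polyRootCountMod ![X² − D] p`). For odd `p ∤ D`,
`ω_D(p) = 1 + (D/p) ∈ {0, 2}` (Legendre symbol), while `ω_D(p) = 1` exactly for `p = 2` and the odd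
`p ∣ D`. So `{p : ω_D(p) = 0}` is the set of primes for which `D` is a quadratic non-residue and
`{p : ω_D(p) = 2}` the set of odd primes `p ∤ D` for which `D` is a residue; each has density
`1/2`, quantitatively:

* `abs_theta_nonresidue_sub_le` / `abs_theta_residue_sub_le` — for every `A`,
  `|∑_{p ≤ x, ω_D(p) = 0} log p − x/2| ≤ C x/(log x)^{A+1}` (`x ≥ 2`), and the same for `ω_D = 2`;
* `card_nonresidue_ge` — `#{p ≤ x : ω_D(p) = 0} ≥ x/(3 log x)` for `x ≥ x₀(D)`;
* (in the sibling file `QuadraticResiduePrimesMertens.lean`) Mertens with rate,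
  `|∑_{p ≤ x, ω_D(p) = 0} 1/p − ((1/2) log log x + c_D)| ≤ K/(log x)^{A+1}`, and its window form.

These are the prime number theorem and Mertens' theorem for the primes in the classes
`(D/p) = ∓1` (Dirichlet; de la Vallée-Poussin), in the explicit-rate currency of the tree. They are
read off the tree's prime ideal theorem for `ℚ(√D)` in the form
`Literature.NumberTheory.LFunctions.DegreeOnePrimes.abs_sum_primesLE_rootCount_mul_log_sub_self_le_logPow`
(`∑_{p ≤ x} ω_D(p) log p = x + O(x/(log x)^A)`), Chebyshev's `θ(x) = x + O(x/(log x)^A)`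
(`Literature.NumberTheory.LFunctions.Mertens.exists_abs_theta_sub_le_div_log_pow`) and the partial
summation `Literature.NumberTheory.LFunctions.ThetaMertens.sum_primesLE_div_of_theta`, through the
identity `[ω = 0] = 1 − ω/2 − [ω = 1]/2` (`ω ≤ 2`). This is the input (9.3)–(9.5) of
Lenstra–Pomerance, *A rigorous time bound for factoring integers*, J. Amer. Math. Soc. **5** (1992),
§9 (proof of Theorem 9.1: "because `d₁d₂` is not a square, we have `π(x; 𝒫) ∼ ½ x/log x`" and
"`S(v, y; 𝒫) = ½ log log y − ½ log log v + O(1/log v)`", there from Davenport, Ch. 20).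
Everything is proved; no named facts.

## References

* H. W. Lenstra Jr., C. Pomerance, J. Amer. Math. Soc. 5 (1992) 483–516, §9, proof of Thm 9.1.
  [LenstraPomerance1992]
* H. Davenport, *Multiplicative Number Theory*, 3rd ed., GTM 74, Ch. 20 (PNT for arithmetic
  progressions), Ch. 7 (Mertens / Dirichlet).
-/

noncomputable section

open Finset Polynomial

namespace Literature.NumberTheory.LFunctions

namespace QuadraticResiduePrimes

open Literature.NumberTheory.Sieve

variable (D : ℤ)

/-! ### The local count `ω_D(p)` -/

/-- `ω_D(p) = #{n < p : p ∣ n² − D}`. [folklore] -/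
theorem omega_eq_card_filter (p : ℕ) :
    polyRootCountMod ![X ^ 2 - C D] p = #((range p).filter fun n : ℕ => (p : ℤ) ∣ (n : ℤ) ^ 2 - D) := by
  rw [polyRootCountMod_single]
  congr 1
  ext n
  simp

/-- `ω_D(p) ≤ 2` for every prime `p` (Lagrange). [folklore] -/
theorem omega_le_two {p : ℕ} (hp : p.Prime) : polyRootCountMod ![X ^ 2 - C D] p ≤ 2 := by
  have h := polyRootCountMod_single_le_natDegree (g := X ^ 2 - C D) hp ?_
  · rw [natDegree_X_pow_sub_C] at h
    exact h
  · rw [leadingCoeff_X_pow_sub_C (by norm_num)]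
    intro h1
    have : (p : ℤ) ∣ ((1 : ℕ) : ℤ) := by simpa using h1
    rw [Int.natCast_dvd_natCast, Nat.dvd_one] at this
    exact hp.one_lt.ne' this

/-- `ω_D(2) = 1`: exactly one of `0² − D`, `1² − D` is even. [folklore] -/
theorem omega_two : polyRootCountMod ![X ^ 2 - C D] 2 = 1 := by
  rw [omega_eq_card_filter, show range 2 = {0, 1} by rfl, filter_insert, filter_singleton]
  by_cases h : (2 : ℤ) ∣ D
  · have h0 : ((2 : ℕ) : ℤ) ∣ ((0 : ℕ) : ℤ) ^ 2 - D := by push_cast; omega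
    have h1 : ¬ ((2 : ℕ) : ℤ) ∣ ((1 : ℕ) : ℤ) ^ 2 - D := by push_cast; omega
    rw [if_pos h0, if_neg h1]
    rfl
  · have h0 : ¬ ((2 : ℕ) : ℤ) ∣ ((0 : ℕ) : ℤ) ^ 2 - D := by push_cast; omega
    have h1 : ((2 : ℕ) : ℤ) ∣ ((1 : ℕ) : ℤ) ^ 2 - D := by push_cast; omega
    rw [if_neg h0, if_pos h1]
    rfl

/-- For a prime `p ∣ D`: `ω_D(p) = 1` (only `n = 0`). [folklore] -/
theorem omega_of_dvd {p : ℕ} (hp : p.Prime) (hpD : (p : ℤ) ∣ D) :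
    polyRootCountMod ![X ^ 2 - C D] p = 1 := by
  rw [omega_eq_card_filter, card_eq_one]
  refine ⟨0, ?_⟩
  ext n
  simp only [mem_filter, mem_range, mem_singleton]
  constructor
  · rintro ⟨hn, hdvd⟩
    have h2 : (p : ℤ) ∣ (n : ℤ) ^ 2 := by
      have := dvd_add hdvd hpD
      simpa using this
    have h3 : (p : ℤ) ∣ (n : ℤ) := Int.Prime.dvd_pow' hp h2
    rw [Int.natCast_dvd_natCast] at h3
    exact Nat.eq_zero_of_dvd_of_lt h3 hn
  · rintro rfl
    refine ⟨hp.pos, ?_⟩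
    simpa using hpD

/-- For an odd prime `p ∤ D`: `ω_D(p) = 1 + (D/p)` (Legendre symbol; Mathlib's
`legendreSym.card_sqrts`). [folklore] -/
theorem omega_eq_one_add_legendreSym {p : ℕ} [Fact p.Prime] (hp2 : p ≠ 2) :
    (polyRootCountMod ![X ^ 2 - C D] p : ℤ) = 1 + legendreSym p D := by
  rw [polyRootCountMod_single_eq_card_zmod, add_comm, ← legendreSym.card_sqrts p hp2 D,
    Set.toFinset_setOf]
  congr 2
  ext x
  simp [sub_eq_zero]

/-- For an odd prime `p ∤ D`, `ω_D(p) ≠ 1`. [folklore] -/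
theorem omega_ne_one {p : ℕ} (hp : p.Prime) (hp2 : p ≠ 2) (hpD : ¬ (p : ℤ) ∣ D) :
    polyRootCountMod ![X ^ 2 - C D] p ≠ 1 := by
  haveI := Fact.mk hp
  intro h1
  have h := omega_eq_one_add_legendreSym D hp2
  rw [h1] at h
  have h0 : legendreSym p D = 0 := by push_cast at h; linarith
  rw [legendreSym.eq_zero_iff, ZMod.intCast_zmod_eq_zero_iff_dvd] at h0
  exact hpD h0

/-- `ω_D(p) = 1` forces `p = 2` or `p ∣ D`. [folklore] -/
theorem eq_two_or_dvd_of_omega_eq_one {p : ℕ} (hp : p.Prime)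
    (h1 : polyRootCountMod ![X ^ 2 - C D] p = 1) : p = 2 ∨ (p : ℤ) ∣ D := by
  by_contra h
  rw [not_or] at h
  exact omega_ne_one D hp h.1 h.2 h1

/-- `X² − D` is monic and, for `D` not a square, irreducible over `ℤ`. [folklore] -/
theorem monic_and_irreducible (hD : ¬ IsSquare D) :
    (X ^ 2 - C D : ℤ[X]).Monic ∧ Irreducible (X ^ 2 - C D : ℤ[X]) := by
  have hm : (X ^ 2 - C D : ℤ[X]).Monic := monic_X_pow_sub_C D (by norm_num)
  refine ⟨hm, ?_⟩
  rw [hm.irreducible_iff_roots_eq_zero_of_degree_le_three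
    (by rw [natDegree_X_pow_sub_C]) (by rw [natDegree_X_pow_sub_C]; norm_num),
    Multiset.eq_zero_iff_forall_notMem]
  intro r hr
  rw [mem_roots (hm.ne_zero), IsRoot.def, eval_sub, eval_pow, eval_X, eval_C, sub_eq_zero] at hr
  exact hD ⟨r, by rw [← hr]; ring⟩

/-! ### Chebyshev estimates with rate for the residue and non-residue primes -/

/-- `(log x)^n ≤ M_n x` for `x ≥ 1`. [folklore] -/
theorem log_pow_le_mul_self (n : ℕ) : ∃ M : ℝ, 0 < M ∧ ∀ x : ℝ, 1 ≤ x → Real.log x ^ n ≤ M * x := by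
  rcases Nat.eq_zero_or_pos n with rfl | hn
  · exact ⟨1, one_pos, fun x hx => by rw [pow_zero]; linarith⟩
  refine ⟨(n : ℝ) ^ n, by positivity, fun x hx => ?_⟩
  have hx0 : 0 ≤ x := by linarith
  have hε : (0 : ℝ) < 1 / n := by positivity
  have h1 : Real.log x ≤ x ^ (1 / (n : ℝ)) / (1 / n) := Real.log_le_rpow_div hx0 hε
  rw [div_div_eq_mul_div, div_one] at h1
  have h2 : 0 ≤ Real.log x := Real.log_nonneg hx
  calc Real.log x ^ n ≤ (x ^ (1 / (n : ℝ)) * n) ^ n := pow_le_pow_left₀ h2 h1 n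
    _ = (n : ℝ) ^ n * (x ^ (1 / (n : ℝ))) ^ n := by rw [mul_pow, mul_comm]
    _ = (n : ℝ) ^ n * x := by
        rw [← Real.rpow_natCast (x ^ (1 / (n : ℝ))) n, ← Real.rpow_mul hx0,
          one_div_mul_cancel (by exact_mod_cast hn.ne'), Real.rpow_one]

/-- The pointwise identities `[ω = 0] = 1 − ω/2 − [ω = 1]/2` and `[ω = 2] = ω/2 − [ω = 1]/2` for
`ω ≤ 2`, multiplied by a weight. [folklore] -/
theorem indicator_identities {ω : ℕ} (h : ω ≤ 2) (L : ℝ) :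
    ((if ω = 0 then L else 0) = L - (ω : ℝ) / 2 * L - (if ω = 1 then L else 0) / 2) ∧
      ((if ω = 2 then L else 0) = (ω : ℝ) / 2 * L - (if ω = 1 then L else 0) / 2) := by
  have : ω = 0 ∨ ω = 1 ∨ ω = 2 := by omega
  rcases this with rfl | rfl | rfl <;> constructor <;> norm_num <;> ring

/-- The ramified primes contribute boundedly: `∑_{p ≤ x, ω_D(p) = 1} log p ≤ K_D` with
`K_D = ∑_{p ∈ {2} ∪ primeFactors |D|} log p` (`D ≠ 0`). [folklore] -/
theorem sum_omega_eq_one_log_le {D : ℤ} (hD0 : D ≠ 0) (N : ℕ) :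
    ∑ p ∈ Nat.primesLE N, (if polyRootCountMod ![X ^ 2 - C D] p = 1 then Real.log p else 0) ≤
      ∑ p ∈ insert 2 D.natAbs.primeFactors, Real.log p := by
  rw [← sum_filter]
  refine sum_le_sum_of_subset_of_nonneg (fun p hp => ?_) fun p _ _ => Real.log_natCast_nonneg p
  obtain ⟨hpP, h1⟩ := mem_filter.1 hp
  have hpr := Nat.prime_of_mem_primesLE hpP
  rcases eq_two_or_dvd_of_omega_eq_one D hpr h1 with rfl | hdvd
  · exact mem_insert_self _ _
  · exact mem_insert_of_mem (Nat.mem_primeFactors.2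
      ⟨hpr, Int.natCast_dvd.1 hdvd, Int.natAbs_ne_zero.2 hD0⟩)

/-- **Chebyshev for the non-residue primes, with rate.** For `D` not a square and every `A`:
`|∑_{p ≤ x, ω_D(p) = 0} log p − x/2| ≤ C x/(log x)^{A+1}` for all `x ≥ 2`. (Prime ideal theorem for
`ℚ(√D)` in the form `∑ ω_D(p) log p = x + O(x/(log x)^{A+1})`, Chebyshev's `θ(x) = x + O(…)`, and
`[ω = 0] = 1 − ω/2 − [ω = 1]/2`.) [cite: LenstraPomerance1992, §9 proof of Thm 9.1] -/
theorem abs_theta_nonresidue_sub_le (hD : ¬ IsSquare D) (A : ℕ) :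
    ∃ B : ℝ, ∀ x : ℝ, 2 ≤ x →
      |∑ p ∈ (Nat.primesLE ⌊x⌋₊).filter (fun p => polyRootCountMod ![X ^ 2 - C D] p = 0),
          Real.log p - x / 2| ≤ B * x / Real.log x ^ (A + 1) := by
  have hD0 : D ≠ 0 := fun h => hD ⟨0, by rw [h, mul_zero]⟩
  obtain ⟨C₁, -, hθ⟩ := Mertens.exists_abs_theta_sub_le_div_log_pow (A + 1)
  obtain ⟨hm, hirr⟩ := monic_and_irreducible D hD
  obtain ⟨C₂, hν⟩ :=
    DegreeOnePrimes.abs_sum_primesLE_rootCount_mul_log_sub_self_le_logPow hm hirr ((A + 1 : ℕ) : ℝ)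
  obtain ⟨M, hM, hlog⟩ := log_pow_le_mul_self (A + 1)
  set K : ℝ := ∑ p ∈ insert 2 D.natAbs.primeFactors, Real.log p with hK
  have hK0 : 0 ≤ K := sum_nonneg fun p _ => Real.log_natCast_nonneg p
  refine ⟨C₁ + C₂ / 2 + K * M / 2, fun x hx => ?_⟩
  set P := Nat.primesLE ⌊x⌋₊ with hP
  set ω : ℕ → ℕ := fun p => polyRootCountMod ![X ^ 2 - C D] p with hω
  have hlx : 0 < Real.log x := Real.log_pos (by linarith)
  have hL : 0 < Real.log x ^ (A + 1) := pow_pos hlx _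
  -- the three inputs
  have hT : |∑ p ∈ P, Real.log p - x| ≤ C₁ * x / Real.log x ^ (A + 1) := by
    rw [← Chebyshev.theta_eq_sum_primesLE]; exact hθ x hx
  have hN : |∑ p ∈ P, (ω p : ℝ) * Real.log p - x| ≤ C₂ * x / Real.log x ^ (A + 1) := by
    have h := hν x hx
    rw [Real.rpow_natCast] at h
    have hs : ∑ p ∈ P, (ω p : ℝ) * Real.log p = ∑ p ∈ P,
        (#((range p).filter fun n : ℕ => (p : ℤ) ∣ (X ^ 2 - C D : ℤ[X]).eval (n : ℤ)) : ℝ) *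
          Real.log p :=
      sum_congr rfl fun p _ => by rw [hω]; simp only; rw [polyRootCountMod_single]
    rw [hs]; exact h
  have hR := sum_omega_eq_one_log_le hD0 ⌊x⌋₊
  have hR0 : 0 ≤ ∑ p ∈ P, (if ω p = 1 then Real.log p else 0) :=
    sum_nonneg fun p _ => by split_ifs; exacts [Real.log_natCast_nonneg p, le_rfl]
  -- the identity
  have hid : ∑ p ∈ P.filter (fun p => ω p = 0), Real.log p =
      (∑ p ∈ P, Real.log p) - (∑ p ∈ P, (ω p : ℝ) * Real.log p) / 2 -
        (∑ p ∈ P, (if ω p = 1 then Real.log p else 0)) / 2 := by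
    rw [sum_filter, sum_div, sum_div, ← sum_sub_distrib, ← sum_sub_distrib]
    refine sum_congr rfl fun p hp => ?_
    rw [(indicator_identities (omega_le_two D (Nat.prime_of_mem_primesLE hp)) (Real.log p)).1]
    ring
  -- absorb the constant
  have hKx : K ≤ K * M * x / Real.log x ^ (A + 1) := by
    rw [le_div_iff₀ hL]
    have h1 := hlog x (by linarith)
    nlinarith
  rw [hid]
  have e : (∑ p ∈ P, Real.log p) - (∑ p ∈ P, (ω p : ℝ) * Real.log p) / 2 -
      (∑ p ∈ P, (if ω p = 1 then Real.log p else 0)) / 2 - x / 2 =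
      ((∑ p ∈ P, Real.log p) - x) - ((∑ p ∈ P, (ω p : ℝ) * Real.log p) - x) / 2 -
        (∑ p ∈ P, (if ω p = 1 then Real.log p else 0)) / 2 := by ring
  rw [e]
  calc |((∑ p ∈ P, Real.log p) - x) - ((∑ p ∈ P, (ω p : ℝ) * Real.log p) - x) / 2 -
        (∑ p ∈ P, (if ω p = 1 then Real.log p else 0)) / 2|
      ≤ |(∑ p ∈ P, Real.log p) - x| + |((∑ p ∈ P, (ω p : ℝ) * Real.log p) - x) / 2| +
          |(∑ p ∈ P, (if ω p = 1 then Real.log p else 0)) / 2| := by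
        have h1 := abs_sub ((∑ p ∈ P, Real.log p) - x - ((∑ p ∈ P, (ω p : ℝ) * Real.log p) - x) / 2)
          ((∑ p ∈ P, (if ω p = 1 then Real.log p else 0)) / 2)
        have h2 := abs_sub ((∑ p ∈ P, Real.log p) - x)
          (((∑ p ∈ P, (ω p : ℝ) * Real.log p) - x) / 2)
        linarith
    _ ≤ C₁ * x / Real.log x ^ (A + 1) + C₂ * x / Real.log x ^ (A + 1) / 2 +
          K * M * x / Real.log x ^ (A + 1) / 2 := by
        rw [abs_div, abs_div, abs_of_pos (show (0 : ℝ) < 2 by norm_num), abs_of_nonneg hR0]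
        gcongr
        exact hR.trans hKx
    _ = (C₁ + C₂ / 2 + K * M / 2) * x / Real.log x ^ (A + 1) := by ring

/-- **Chebyshev for the residue primes, with rate**: `|∑_{p ≤ x, ω_D(p) = 2} log p − x/2| ≤
C x/(log x)^{A+1}` (`x ≥ 2`), from `[ω = 2] = ω/2 − [ω = 1]/2`.
[cite: LenstraPomerance1992, §9 proof of Thm 9.1] -/
theorem abs_theta_residue_sub_le (hD : ¬ IsSquare D) (A : ℕ) :
    ∃ B : ℝ, ∀ x : ℝ, 2 ≤ x →
      |∑ p ∈ (Nat.primesLE ⌊x⌋₊).filter (fun p => polyRootCountMod ![X ^ 2 - C D] p = 2),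
          Real.log p - x / 2| ≤ B * x / Real.log x ^ (A + 1) := by
  have hD0 : D ≠ 0 := fun h => hD ⟨0, by rw [h, mul_zero]⟩
  obtain ⟨hm, hirr⟩ := monic_and_irreducible D hD
  obtain ⟨C₂, hν⟩ :=
    DegreeOnePrimes.abs_sum_primesLE_rootCount_mul_log_sub_self_le_logPow hm hirr ((A + 1 : ℕ) : ℝ)
  obtain ⟨M, hM, hlog⟩ := log_pow_le_mul_self (A + 1)
  set K : ℝ := ∑ p ∈ insert 2 D.natAbs.primeFactors, Real.log p with hK
  have hK0 : 0 ≤ K := sum_nonneg fun p _ => Real.log_natCast_nonneg p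
  refine ⟨C₂ / 2 + K * M / 2, fun x hx => ?_⟩
  set P := Nat.primesLE ⌊x⌋₊ with hP
  set ω : ℕ → ℕ := fun p => polyRootCountMod ![X ^ 2 - C D] p with hω
  have hlx : 0 < Real.log x := Real.log_pos (by linarith)
  have hL : 0 < Real.log x ^ (A + 1) := pow_pos hlx _
  have hN : |∑ p ∈ P, (ω p : ℝ) * Real.log p - x| ≤ C₂ * x / Real.log x ^ (A + 1) := by
    have h := hν x hx
    rw [Real.rpow_natCast] at h
    have hs : ∑ p ∈ P, (ω p : ℝ) * Real.log p = ∑ p ∈ P,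
        (#((range p).filter fun n : ℕ => (p : ℤ) ∣ (X ^ 2 - C D : ℤ[X]).eval (n : ℤ)) : ℝ) *
          Real.log p :=
      sum_congr rfl fun p _ => by rw [hω]; simp only; rw [polyRootCountMod_single]
    rw [hs]; exact h
  have hR := sum_omega_eq_one_log_le hD0 ⌊x⌋₊
  have hR0 : 0 ≤ ∑ p ∈ P, (if ω p = 1 then Real.log p else 0) :=
    sum_nonneg fun p _ => by split_ifs; exacts [Real.log_natCast_nonneg p, le_rfl]
  have hid : ∑ p ∈ P.filter (fun p => ω p = 2), Real.log p =
      (∑ p ∈ P, (ω p : ℝ) * Real.log p) / 2 -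
        (∑ p ∈ P, (if ω p = 1 then Real.log p else 0)) / 2 := by
    rw [sum_filter, sum_div, sum_div, ← sum_sub_distrib]
    refine sum_congr rfl fun p hp => ?_
    rw [(indicator_identities (omega_le_two D (Nat.prime_of_mem_primesLE hp)) (Real.log p)).2]
    ring
  have hKx : K ≤ K * M * x / Real.log x ^ (A + 1) := by
    rw [le_div_iff₀ hL]
    have h1 := hlog x (by linarith)
    nlinarith
  rw [hid]
  have e : (∑ p ∈ P, (ω p : ℝ) * Real.log p) / 2 -
      (∑ p ∈ P, (if ω p = 1 then Real.log p else 0)) / 2 - x / 2 =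
      ((∑ p ∈ P, (ω p : ℝ) * Real.log p) - x) / 2 -
        (∑ p ∈ P, (if ω p = 1 then Real.log p else 0)) / 2 := by ring
  rw [e]
  calc |((∑ p ∈ P, (ω p : ℝ) * Real.log p) - x) / 2 -
        (∑ p ∈ P, (if ω p = 1 then Real.log p else 0)) / 2|
      ≤ |((∑ p ∈ P, (ω p : ℝ) * Real.log p) - x) / 2| +
          |(∑ p ∈ P, (if ω p = 1 then Real.log p else 0)) / 2| := abs_sub _ _
    _ ≤ C₂ * x / Real.log x ^ (A + 1) / 2 + K * M * x / Real.log x ^ (A + 1) / 2 := by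
        rw [abs_div, abs_div, abs_of_pos (show (0 : ℝ) < 2 by norm_num), abs_of_nonneg hR0]
        gcongr
        exact hR.trans hKx
    _ = (C₂ / 2 + K * M / 2) * x / Real.log x ^ (A + 1) := by ring

/-! ### Half the primes are non-residues: a lower bound for the count -/

/-- **At least a third of `x/log x` primes `p ≤ x` have `(D/p) = −1`**, for `x ≥ x₀(D)`: 
`#{p ≤ x : ω_D(p) = 0} ≥ x/(3 log x)`. (From `abs_theta_nonresidue_sub_le` with `A = 0` and
`log p ≤ log x`.) This is "`π(x; 𝒫) ≥ ⅓ x/log x` for all `x` beyond some constant" in the proof of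
[LP92, Thm 9.1]. [cite: LenstraPomerance1992, §9 proof of Thm 9.1] -/
theorem card_nonresidue_ge (hD : ¬ IsSquare D) :
    ∃ x₀ : ℝ, ∀ x : ℝ, x₀ ≤ x →
      x / (3 * Real.log x) ≤
        #((Nat.primesLE ⌊x⌋₊).filter fun p => polyRootCountMod ![X ^ 2 - C D] p = 0) := by
  obtain ⟨B, hB⟩ := abs_theta_nonresidue_sub_le D hD 0
  refine ⟨max 2 (Real.exp (6 * max B 0)), fun x hx => ?_⟩
  have hx2 : 2 ≤ x := le_trans (le_max_left _ _) hx
  have hx0 : 0 < x := by linarith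
  have hlogx : 6 * max B 0 ≤ Real.log x := by
    have h := le_trans (le_max_right _ _) hx
    exact (Real.le_log_iff_exp_le hx0).2 h
  have hlog0 : 0 < Real.log x := Real.log_pos (by linarith)
  set F := (Nat.primesLE ⌊x⌋₊).filter fun p => polyRootCountMod ![X ^ 2 - C D] p = 0 with hF
  have hθF : ∑ p ∈ F, Real.log p ≤ #F * Real.log x := by
    have h : ∀ p ∈ F, Real.log p ≤ Real.log x := by
      intro p hp
      have hpP := (mem_filter.1 hp).1
      have hp1 := (Nat.prime_of_mem_primesLE hpP).pos
      have hpx : (p : ℝ) ≤ x :=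
        le_trans (by exact_mod_cast Nat.le_of_mem_primesLE hpP) (Nat.floor_le hx0.le)
      exact Real.log_le_log (by exact_mod_cast hp1) hpx
    calc ∑ p ∈ F, Real.log p ≤ ∑ p ∈ F, Real.log x := sum_le_sum h
      _ = #F * Real.log x := by rw [sum_const, nsmul_eq_mul]
  have h1 := hB x hx2
  rw [zero_add, pow_one] at h1
  have h2 : x / 2 - B * x / Real.log x ≤ ∑ p ∈ F, Real.log p := by
    have := (abs_le.1 h1).1; linarith
  have h3 : B * x / Real.log x ≤ x / 6 := by
    rw [div_le_iff₀ hlog0]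
    have hB' : B ≤ max B 0 := le_max_left _ _
    have h0' : 0 ≤ max B 0 := le_max_right _ _
    nlinarith
  have h4 : x / 3 ≤ #F * Real.log x := by linarith
  rw [div_le_iff₀ (by positivity)]
  nlinarith

end QuadraticResiduePrimes

end Literature.NumberTheory.LFunctions

end
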